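import Mathlib
import Literature.NumberTheory.LFunctions.Zhang2022.Section18RangeToolsC
import Literature.NumberTheory.LFunctions.Zhang2022.Section18SjNormSizes
import HarnessLib

/-!
# Zhang (2022) §18, proof of (2.33): "the sum over `dr < P^{0.5}` contributes `o(α)`" from
# Lemmas 10.1–10.2, kernel-checked

Topic `Literature/NumberTheory/LFunctions/Zhang2022` (Landau–Siegel audit tree; verdict-neutral).
Y. Zhang, *Discrete mean estimates and the Landau–Siegel zero*, arXiv:2211.02515v1 (2022)
[Zhang2022LandauSiegel], §18 p. 100 (prose tex L4932): "By the discussion in Section 8 and 10, the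
sum over `dr < P^{0.5}` contributes `o(α)`" — the first of the four range evaluations of
`S_j(𝐚₂₃,𝐚₂₃)` (GAP-LEDGER G-d56-1; cone leaf C27 `Skeleton.Ded183`; typed node
`TypedSection18.Step18_range1`; RULING 13d: R1 → sz-d56). PROVED here as the implication

* `step18_range1_of : Skeleton.Lemma101 c′ → Skeleton.Lemma102 c′ → Step18_range1 c′`

from the manuscript's own Lemmas 10.1–10.2 (CLAIM nodes `Skeleton.Lemma101/102`, antecedents of
`Ded183` itself) and nothing else: by K1 (`sj23Term_eq_frakv`) the piece is
`Σ_{dr<P^{1/2}} w(d,r)𝔳₁ⱼ(dr)𝔳₂ⱼ(d,r)` with `|w| ≤ ∏_{q∣dr}(1+25/q)/(drφ(r))`; on `dr ≤ P^{1/2}/T`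
(10.2) gives `|𝔳₁ⱼ| ≤ CT^{−c}` and (10.8) gives `|𝔳₂ⱼ| ≤ |L′||Π|·9π²(1+5|c′|)²/(500𝓛⁹) + C𝓛⁻¹⁵`, on
the window `P^{1/2}/T < dr < P^{1/2}` (10.5)/(10.11) give `|𝔳₁ⱼ|, |𝔳₂ⱼ| ≤ C𝓛⁻⁷`; the weight masses
are `≪ 𝓛⁹` (full range) and `≪ 𝓛^{1.1}` (window) by `full_mass_le`/`window_mass_le`, and
`T^{−c}` beats every power of `𝓛` — total `O(𝓛⁻¹⁰ + 𝓛^{−12.9}) = o(α)`, `α = π𝓛⁻⁹`.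

* `range1_bound_at` is the same estimate at a fixed `D` with the four Lemma-10.x clauses as explicit
  hypotheses (the numerical heart; no `ForAllLarge`).

No new definition, no named fact; nothing here bears on Theorems 1–2 or on Landau–Siegel zeros.

## References

* Y. Zhang, arXiv:2211.02515v1 (2022), §18 p. 100; §10 Lemma 10.1 (10.2), (10.5), Lemma 10.2
  (10.8), (10.11); §2 (2.10). [cite: Zhang2022LandauSiegel, §18 p.100]
-/

noncomputable section

open Complex Real Finset

namespace Literature.NumberTheory.LFunctions.Zhang2022.Sec18SjNorm

open Skeleton Typed.Section18

section Range1

variable (c' : ℝ) {D : ℕ} [NeZero D] (χ : DirichletCharacter ℂ D)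

omit [NeZero D] χ in
/-- For every real `M` there is `D₀` with `M ≤ log D` for all `D ≥ D₀`. [folklore] -/
private theorem exists_nat_le_log (M : ℝ) : ∃ D₀ : ℕ, ∀ D : ℕ, D₀ ≤ D → M ≤ Real.log D := by
  refine ⟨⌈Real.exp M⌉₊ + 1, fun D hD => ?_⟩
  have h1 : Real.exp M ≤ D := by
    have : (⌈Real.exp M⌉₊ : ℝ) + 1 ≤ D := by exact_mod_cast hD
    linarith [Nat.le_ceil (Real.exp M)]
  have hD0 : (0 : ℝ) < D := lt_of_lt_of_le (Real.exp_pos M) h1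
  rw [Real.le_log_iff_exp_le hD0]
  exact h1

set_option maxHeartbeats 400000 in
/-- **The first-range estimate at a fixed `D`** (the numerical heart of `Step18_range1`): for `χ`
primitive, `𝓛 = log D ≥ 3`, `j` arbitrary, and the four clauses of Lemmas 10.1–10.2 on the first range
as hypotheses with constants `C₁, C₂ ≥ 0`, `c > 0` — (10.2) `|𝔳₁ⱼ(y)| ≤ C₁T^{−c}` (`1 ≤ y ≤ P^{1/2}/T`),
(10.5) `|𝔳₁ⱼ(y)| ≤ C₁𝓛⁻⁷` (`P^{1/2}/T < y ≤ P^{1/2}`), (10.8) `|𝔳₂ⱼ(d,r) − L′Π(d,r)β_{j+1}β_{j+2}log P/500|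
≤ C₂𝓛⁻¹⁵` (`dr ≤ P^{1/2}/T`), (10.11) `|𝔳₂ⱼ(d,r)| ≤ C₂𝓛⁻⁷` (`P^{1/2}/T < dr ≤ P^{1/2}`) — one has
`‖Sj23Range(0, P^{1/2})‖ ≤ K_t·𝓛⁻¹⁰ + K_w·𝓛^{1.1}𝓛⁻¹⁴` with the explicit
`K_t = C₁(G + C₂)(1 + 6e³²⁰)·19!/c¹⁹`, `G = 4e^{9/2}(3π(1+5|c′|))²/500`, `K_w = 8e⁷⁷C₁C₂`.
[cite: Zhang2022LandauSiegel, §18 p.100; §10 (10.2), (10.5), (10.8), (10.11)] -/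
theorem range1_bound_at (hL : 3 ≤ ell D) (hprim : χ.IsPrimitive) (j : ℕ) {c C₁ C₂ : ℝ}
    (hc : 0 < c) (hC₁ : 0 ≤ C₁) (hC₂ : 0 ≤ C₂)
    (hv1t : ∀ y : ℝ, 1 ≤ y → y ≤ bigP D ^ (0.5 : ℝ) / bigT D → ‖frakv1 c' χ j y‖ ≤ C₁ * bigT D ^ (-c))
    (hv1w : ∀ y : ℝ, bigP D ^ (0.5 : ℝ) / bigT D < y → y ≤ bigP D ^ (0.5 : ℝ) →
      ‖frakv1 c' χ j y‖ ≤ C₁ * (ell D ^ 7)⁻¹)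
    (hv2t : ∀ d r : ℕ, 1 ≤ d → 1 ≤ r → ((d * r : ℕ) : ℝ) ≤ bigP D ^ (0.5 : ℝ) / bigT D →
      ‖frakv2 c' χ j d r - deriv χ.LFunction 1 * PiW χ d r / 500 *
          (betaJ c' D (j + 1) * betaJ c' D (j + 2)) * Real.log (bigP D)‖ ≤ C₂ * (ell D ^ 15)⁻¹)
    (hv2w : ∀ d r : ℕ, 1 ≤ d → 1 ≤ r → bigP D ^ (0.5 : ℝ) / bigT D < ((d * r : ℕ) : ℝ) →
      ((d * r : ℕ) : ℝ) ≤ bigP D ^ (0.5 : ℝ) → ‖frakv2 c' χ j d r‖ ≤ C₂ * (ell D ^ 7)⁻¹) :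
    ‖Sj23Range c' χ j 0 (bigP D ^ (0.5 : ℝ))‖ ≤
      C₁ * (4 * Real.exp (9 / 2) * (3 * π * (1 + 5 * |c'|)) ^ 2 / 500 + C₂) *
          (1 + 6 * Real.exp 320) * (((9 + 10).factorial : ℝ) / c ^ (9 + 10)) / ell D ^ 10 +
        8 * Real.exp 77 * C₁ * C₂ * ell D ^ (1.1 : ℝ) / ell D ^ 14 := by
  -- sizes
  have hL2 : 2 ≤ ell D := by linarith
  have hL1 : 1 ≤ ell D := by linarith
  have hℓ : 0 < ell D := by linarith
  have hlogD : 2 ≤ Real.log D := hL2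
  have hP : 0 < bigP D := Real.exp_pos _
  have hPa : 0 < bigP D ^ (0.5 : ℝ) := Real.rpow_pos_of_pos hP _
  have hT : 0 < bigT D := Real.exp_pos _
  have hT1 : 1 ≤ bigT D := Real.one_le_exp (by rw [ell] at hℓ; positivity)
  have hTc : 0 < bigT D ^ (-c) := Real.rpow_pos_of_pos hT _
  set b0 : ℝ := 3 * π * (1 + 5 * |c'|) with hb0
  have hb00 : 0 ≤ b0 := by positivity
  set G : ℝ := 4 * Real.exp (9 / 2) * b0 ^ 2 / 500 with hG
  have hG0 : 0 ≤ G := by positivity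
  -- `|β_k| ≤ b0/𝓛⁹`, `|L′| ≤ 4e^{9/2}𝓛²`, `log P = 𝓛⁹`
  have hβ : ∀ k, ‖betaJ c' D k‖ ≤ b0 / ell D ^ 9 := fun k => norm_betaJ_le_div c' hL2 k
  have hLd : ‖deriv χ.LFunction 1‖ ≤ 4 * Real.exp (9 / 2) * ell D ^ 2 := by
    have hL' : 3 ≤ Real.log D := hL
    have hd := Lemma31.norm_deriv_LFunction_le_near_one χ hL' hprim (w := 1) (by simp; positivity)
    refine hd.trans ?_
    change 2 * Real.exp (9 / 2) * (1 + ell D) * ell D ≤ 4 * Real.exp (9 / 2) * ell D ^ 2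
    have h0 : 0 ≤ Real.exp (9 / 2) := (Real.exp_pos _).le
    nlinarith [mul_nonneg h0 hℓ.le]
  -- the majorant of the piece (K1)
  have hmaj := norm_Sj23Range_le_majorant c' χ hlogD j 0 (bigP D ^ (0.5 : ℝ))
  -- the two regions' weights
  set Z : ℕ := ⌊bigP D ^ (0.5 : ℝ)⌋₊ with hZ
  have hZ1 : 1 ≤ Z := by
    rw [hZ]; apply Nat.one_le_floor_iff _ |>.mpr
    exact Real.one_le_rpow (Real.one_le_exp (pow_nonneg hℓ.le 9)) (by norm_num)
  set h25 : ℕ → ℝ := fun n => ∏ q ∈ n.primeFactors, (1 + 25 / (q : ℝ)) with hh25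
  set h106 : ℕ → ℝ := fun n => ∏ q ∈ n.primeFactors, (1 + 106 / (q : ℝ)) with hh106
  have h25_nonneg : ∀ n, 0 ≤ h25 n := fun n => prod_nonneg fun q _ => by positivity
  -- pointwise bound of `𝔳₂` on the tiny range: `‖𝔳₂‖ ≤ (G + C₂)·∏(1+2/q)²`
  have hv2t' : ∀ d r : ℕ, 1 ≤ d → 1 ≤ r → ((d * r : ℕ) : ℝ) ≤ bigP D ^ (0.5 : ℝ) / bigT D →
      ‖frakv2 c' χ j d r‖ ≤ (G + C₂) * ∏ q ∈ (d * r).primeFactors, (1 + 2 / (q : ℝ)) ^ 2 := by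
    intro d r hd hr hdr
    have hPi := norm_PiW_le_prod χ (d := d) (r := r) (by omega) (by omega)
    set Pi2 : ℝ := ∏ q ∈ (d * r).primeFactors, (1 + 2 / (q : ℝ)) ^ 2 with hPi2
    have hPi2_one : 1 ≤ Pi2 := Finset.one_le_prod fun q _ => by
      have : 0 ≤ 2 / (q : ℝ) := by positivity
      nlinarith
    have hmain : ‖deriv χ.LFunction 1 * PiW χ d r / 500 *
        (betaJ c' D (j + 1) * betaJ c' D (j + 2)) * Real.log (bigP D)‖ ≤ G * Pi2 := by
      rw [norm_mul, norm_mul, norm_div, norm_mul, norm_mul, Complex.norm_real, Real.norm_eq_abs,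
        log_bigP, abs_of_pos (by positivity), RCLike.norm_ofNat]
      have s1 : ‖deriv χ.LFunction 1‖ * ‖PiW χ d r‖ ≤ (4 * Real.exp (9 / 2) * ell D ^ 2) * Pi2 :=
        mul_le_mul hLd hPi (norm_nonneg _) (by positivity)
      have s2 : ‖betaJ c' D (j + 1)‖ * ‖betaJ c' D (j + 2)‖ ≤ (b0 / ell D ^ 9) * (b0 / ell D ^ 9) :=
        mul_le_mul (hβ _) (hβ _) (norm_nonneg _) (by positivity)
      calc ‖deriv χ.LFunction 1‖ * ‖PiW χ d r‖ / 500 *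
            (‖betaJ c' D (j + 1)‖ * ‖betaJ c' D (j + 2)‖) * ell D ^ 9
          = (‖deriv χ.LFunction 1‖ * ‖PiW χ d r‖) *
              (‖betaJ c' D (j + 1)‖ * ‖betaJ c' D (j + 2)‖) * (ell D ^ 9 / 500) := by ring
        _ ≤ ((4 * Real.exp (9 / 2) * ell D ^ 2) * Pi2) * ((b0 / ell D ^ 9) * (b0 / ell D ^ 9)) *
              (ell D ^ 9 / 500) := by
            apply mul_le_mul_of_nonneg_right _ (by positivity)
            exact mul_le_mul s1 s2 (by positivity) (by positivity)
        _ = G * Pi2 * (ell D ^ 2 / ell D ^ 9) := by rw [hG]; field_simp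
        _ ≤ G * Pi2 * 1 := by
            gcongr
            rw [div_le_one (by positivity)]
            exact pow_le_pow_right₀ hL1 (by norm_num)
        _ = G * Pi2 := mul_one _
    have herr : C₂ * (ell D ^ 15)⁻¹ ≤ C₂ * Pi2 := by
      have : (ell D ^ 15)⁻¹ ≤ 1 := inv_le_one_of_one_le₀ (one_le_pow₀ hL1)
      nlinarith
    calc ‖frakv2 c' χ j d r‖
        ≤ ‖frakv2 c' χ j d r - deriv χ.LFunction 1 * PiW χ d r / 500 *
              (betaJ c' D (j + 1) * betaJ c' D (j + 2)) * Real.log (bigP D)‖ +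
            ‖deriv χ.LFunction 1 * PiW χ d r / 500 *
              (betaJ c' D (j + 1) * betaJ c' D (j + 2)) * Real.log (bigP D)‖ :=
          norm_le_norm_sub_add _ _
      _ ≤ C₂ * Pi2 + G * Pi2 := add_le_add ((hv2t d r hd hr hdr).trans herr) hmain
      _ = (G + C₂) * Pi2 := by ring
  -- termwise splitting of the indicator `0 ≤ dr < P^{1/2}` into tiny + window
  have hterm : ∀ r ∈ Ico 1 (Nsupp D), ∀ d ∈ Ico 1 (Nsupp D),
      (if (0 : ℝ) ≤ ((d * r : ℕ) : ℝ) ∧ ((d * r : ℕ) : ℝ) < bigP D ^ (0.5 : ℝ) then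
          h25 (d * r) / ((d : ℝ) * r * Nat.totient r) *
            ‖frakv1 c' χ j ((d * r : ℕ) : ℝ)‖ * ‖frakv2 c' χ j d r‖ else 0) ≤
        (C₁ * bigT D ^ (-c) * (G + C₂)) *
          (if d * r ≤ Z then h106 (d * r) / ((d : ℝ) * r * Nat.totient r) else 0) +
        (C₁ * (ell D ^ 7)⁻¹ * (C₂ * (ell D ^ 7)⁻¹)) *
          (if bigP D ^ (1 / 2 : ℝ) / bigT D < ((d * r : ℕ) : ℝ) ∧ ((d * r : ℕ) : ℝ) ≤ bigP D ^ (1 / 2 : ℝ)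
            then h25 (d * r) / ((d : ℝ) * r * Nat.totient r) else 0) := by
    intro r hr d hd
    have hr1 : 1 ≤ r := (mem_Ico.mp hr).1
    have hd1 : 1 ≤ d := (mem_Ico.mp hd).1
    have hdr1 : (1 : ℝ) ≤ ((d * r : ℕ) : ℝ) := by exact_mod_cast Nat.mul_pos hd1 hr1
    have hwpos : 0 < (d : ℝ) * r * Nat.totient r := by
      have : (0:ℝ) < d := by exact_mod_cast hd1
      have : (0:ℝ) < r := by exact_mod_cast hr1
      have : (0:ℝ) < Nat.totient r := by exact_mod_cast Nat.totient_pos.mpr hr1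
      positivity
    have hw0 : 0 ≤ h25 (d * r) / ((d : ℝ) * r * Nat.totient r) := div_nonneg (h25_nonneg _) hwpos.le
    have hw106 : 0 ≤ h106 (d * r) / ((d : ℝ) * r * Nat.totient r) :=
      div_nonneg (prod_nonneg fun q _ => by positivity) hwpos.le
    have hhalf : bigP D ^ (1 / 2 : ℝ) = bigP D ^ (0.5 : ℝ) := by norm_num
    have hA0 : 0 ≤ C₁ * bigT D ^ (-c) * (G + C₂) := by positivity
    have hB0 : 0 ≤ C₁ * (ell D ^ 7)⁻¹ * (C₂ * (ell D ^ 7)⁻¹) := by positivity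
    by_cases hcond : (0 : ℝ) ≤ ((d * r : ℕ) : ℝ) ∧ ((d * r : ℕ) : ℝ) < bigP D ^ (0.5 : ℝ)
    · rw [if_pos hcond]
      have hdrZ : d * r ≤ Z := by rw [hZ]; exact Nat.le_floor hcond.2.le
      rw [if_pos hdrZ]
      by_cases htiny : ((d * r : ℕ) : ℝ) ≤ bigP D ^ (0.5 : ℝ) / bigT D
      · -- tiny range
        have e1 := hv1t _ hdr1 htiny
        have e2 := hv2t' d r hd1 hr1 htiny
        have hweight : h25 (d * r) / ((d : ℝ) * r * Nat.totient r) *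
            (∏ q ∈ (d * r).primeFactors, (1 + 2 / (q : ℝ)) ^ 2) ≤
            h106 (d * r) / ((d : ℝ) * r * Nat.totient r) := by
          rw [div_mul_eq_mul_div]
          exact div_le_div_of_nonneg_right (prod25_mul_prod2_sq_le (d * r)) hwpos.le
        calc h25 (d * r) / ((d : ℝ) * r * Nat.totient r) *
              ‖frakv1 c' χ j ((d * r : ℕ) : ℝ)‖ * ‖frakv2 c' χ j d r‖
            ≤ h25 (d * r) / ((d : ℝ) * r * Nat.totient r) * (C₁ * bigT D ^ (-c)) *
                ((G + C₂) * ∏ q ∈ (d * r).primeFactors, (1 + 2 / (q : ℝ)) ^ 2) :=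
              mul_le_mul (mul_le_mul_of_nonneg_left e1 hw0) e2 (norm_nonneg _)
                (mul_nonneg hw0 (by positivity))
          _ = (C₁ * bigT D ^ (-c) * (G + C₂)) * (h25 (d * r) / ((d : ℝ) * r * Nat.totient r) *
                (∏ q ∈ (d * r).primeFactors, (1 + 2 / (q : ℝ)) ^ 2)) := by ring
          _ ≤ (C₁ * bigT D ^ (-c) * (G + C₂)) * (h106 (d * r) / ((d : ℝ) * r * Nat.totient r)) :=
              mul_le_mul_of_nonneg_left hweight hA0
          _ ≤ _ := by
              have : 0 ≤ (C₁ * (ell D ^ 7)⁻¹ * (C₂ * (ell D ^ 7)⁻¹)) *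
                  (if bigP D ^ (1 / 2 : ℝ) / bigT D < ((d * r : ℕ) : ℝ) ∧
                      ((d * r : ℕ) : ℝ) ≤ bigP D ^ (1 / 2 : ℝ)
                    then h25 (d * r) / ((d : ℝ) * r * Nat.totient r) else 0) :=
                mul_nonneg hB0 (by split_ifs <;> [exact hw0; exact le_rfl])
              linarith
      · -- window
        push Not at htiny
        have hwin : bigP D ^ (1 / 2 : ℝ) / bigT D < ((d * r : ℕ) : ℝ) ∧
            ((d * r : ℕ) : ℝ) ≤ bigP D ^ (1 / 2 : ℝ) := by
          rw [hhalf]; exact ⟨htiny, hcond.2.le⟩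
        rw [if_pos hwin]
        have e1 := hv1w _ htiny hcond.2.le
        have e2 := hv2w d r hd1 hr1 htiny hcond.2.le
        calc h25 (d * r) / ((d : ℝ) * r * Nat.totient r) *
              ‖frakv1 c' χ j ((d * r : ℕ) : ℝ)‖ * ‖frakv2 c' χ j d r‖
            ≤ h25 (d * r) / ((d : ℝ) * r * Nat.totient r) * (C₁ * (ell D ^ 7)⁻¹) *
                (C₂ * (ell D ^ 7)⁻¹) :=
              mul_le_mul (mul_le_mul_of_nonneg_left e1 hw0) e2 (norm_nonneg _)
                (mul_nonneg hw0 (by positivity))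
          _ = (C₁ * (ell D ^ 7)⁻¹ * (C₂ * (ell D ^ 7)⁻¹)) *
                (h25 (d * r) / ((d : ℝ) * r * Nat.totient r)) := by ring
          _ ≤ _ := by
              have : 0 ≤ (C₁ * bigT D ^ (-c) * (G + C₂)) *
                  (h106 (d * r) / ((d : ℝ) * r * Nat.totient r)) := mul_nonneg hA0 hw106
              linarith
    · rw [if_neg hcond]
      positivity
  -- sum the two majorants
  have hsumT := full_mass_le (c := 106) (by norm_num) hZ1 (Nsupp D)
  have hsumW := window_mass_le (c := 25) (by norm_num) (a := 1 / 2) (by norm_num) hL2 (Nsupp D)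
  have hS : ‖Sj23Range c' χ j 0 (bigP D ^ (0.5 : ℝ))‖ ≤
      (C₁ * bigT D ^ (-c) * (G + C₂)) * (1 + 2 * Real.exp (3 * 106 + 2) * (2 + Real.log Z)) +
      (C₁ * (ell D ^ 7)⁻¹ * (C₂ * (ell D ^ 7)⁻¹)) *
        (2 * Real.exp (3 * 25 + 2) * (3 + ell D ^ (1.1 : ℝ))) := by
    refine hmaj.trans ?_
    refine (sum_le_sum fun r hr => sum_le_sum fun d hd => hterm r hr d hd).trans ?_
    have hA0 : 0 ≤ C₁ * bigT D ^ (-c) * (G + C₂) := by positivity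
    have hB0 : 0 ≤ C₁ * (ell D ^ 7)⁻¹ * (C₂ * (ell D ^ 7)⁻¹) := by positivity
    simp only [sum_add_distrib, ← mul_sum]
    exact add_le_add (mul_le_mul_of_nonneg_left hsumT hA0) (mul_le_mul_of_nonneg_left hsumW hB0)
  -- `log Z ≤ 𝓛⁹/2`
  have hlogZ : Real.log Z ≤ ell D ^ 9 / 2 := by
    have hZle : (Z : ℝ) ≤ bigP D ^ (0.5 : ℝ) := Nat.floor_le hPa.le
    have hZpos : (0 : ℝ) < Z := by exact_mod_cast hZ1
    calc Real.log Z ≤ Real.log (bigP D ^ (0.5 : ℝ)) := Real.log_le_log hZpos hZle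
      _ = 0.5 * ell D ^ 9 := by rw [Real.log_rpow hP, log_bigP]
      _ = ell D ^ 9 / 2 := by ring
  -- tiny total ≤ K_t / 𝓛¹⁰
  have h9 : 1 ≤ ell D ^ 9 := one_le_pow₀ hL1
  have htiny : (C₁ * bigT D ^ (-c) * (G + C₂)) * (1 + 2 * Real.exp (3 * 106 + 2) * (2 + Real.log Z)) ≤
      C₁ * (G + C₂) * (1 + 6 * Real.exp 320) * (((9 + 10).factorial : ℝ) / c ^ (9 + 10)) / ell D ^ 10 := by
    have hmass : 1 + 2 * Real.exp (3 * 106 + 2) * (2 + Real.log Z) ≤ (1 + 6 * Real.exp 320) * ell D ^ 9 := by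
      have e : (3 : ℝ) * 106 + 2 = 320 := by norm_num
      rw [e]
      have hexp := Real.exp_pos 320
      nlinarith
    have hTk := bigT_rpow_neg_mul_pow_le hc 9 hL1
    calc (C₁ * bigT D ^ (-c) * (G + C₂)) * (1 + 2 * Real.exp (3 * 106 + 2) * (2 + Real.log Z))
        ≤ (C₁ * bigT D ^ (-c) * (G + C₂)) * ((1 + 6 * Real.exp 320) * ell D ^ 9) :=
          mul_le_mul_of_nonneg_left hmass (by positivity)
      _ = C₁ * (G + C₂) * (1 + 6 * Real.exp 320) * (bigT D ^ (-c) * ell D ^ 9) := by ring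
      _ ≤ C₁ * (G + C₂) * (1 + 6 * Real.exp 320) * (((9 + 10).factorial : ℝ) / c ^ (9 + 10) / ell D ^ 10) :=
          mul_le_mul_of_nonneg_left hTk (by positivity)
      _ = _ := by ring
  -- window total ≤ K_w 𝓛^{1.1}/𝓛¹⁴
  have hwin : (C₁ * (ell D ^ 7)⁻¹ * (C₂ * (ell D ^ 7)⁻¹)) *
        (2 * Real.exp (3 * 25 + 2) * (3 + ell D ^ (1.1 : ℝ))) ≤
      8 * Real.exp 77 * C₁ * C₂ * ell D ^ (1.1 : ℝ) / ell D ^ 14 := by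
    have e : (3 : ℝ) * 25 + 2 = 77 := by norm_num
    rw [e]
    set u : ℝ := ell D ^ (1.1 : ℝ) with hu
    set v : ℝ := (ell D ^ 7)⁻¹ with hv
    have hu1 : 1 ≤ u := Real.one_le_rpow hL1 (by norm_num)
    have hv0 : 0 ≤ v := by positivity
    have hvv : v * v = 1 / ell D ^ 14 := by rw [hv]; field_simp
    have hK : 0 ≤ 2 * Real.exp 77 * C₁ * C₂ * (v * v) := by positivity
    calc C₁ * v * (C₂ * v) * (2 * Real.exp 77 * (3 + u))
        = 2 * Real.exp 77 * C₁ * C₂ * (v * v) * (3 + u) := by ring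
      _ ≤ 2 * Real.exp 77 * C₁ * C₂ * (v * v) * (4 * u) := by
          apply mul_le_mul_of_nonneg_left _ hK; linarith
      _ = 8 * Real.exp 77 * C₁ * C₂ * u * (v * v) := by ring
      _ = 8 * Real.exp 77 * C₁ * C₂ * u / ell D ^ 14 := by rw [hvv]; ring
  linarith [hS, htiny, hwin]

/-- **`Z22:§18.u009`-prose, "the sum over `dr < P^{0.5}` contributes `o(α)`", from Lemmas 10.1–10.2**
(`TypedSection18.Step18_range1`): for every `c′`, `Skeleton.Lemma101 c′ → Skeleton.Lemma102 c′ →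
Step18_range1 c′`. Assembly of `range1_bound_at` with `α = π𝓛⁻⁹`: the bound
`K_t𝓛⁻¹⁰ + K_w𝓛^{1.1−14}` is `≤ επ𝓛⁻⁹` once `𝓛 ≥ 2K_t/(επ)` and `𝓛 ≥ 2K_w/(επ)` (`𝓛^{3.9} ≥ 𝓛`).
Kernel-checked; the antecedents are CLAIM nodes of the manuscript (Lemmas 10.1, 10.2), themselves
antecedents of the leaf `Skeleton.Ded183`. [cite: Zhang2022LandauSiegel, §18 p.100] -/
theorem step18_range1_of (h101 : Skeleton.Lemma101 c') (h102 : Skeleton.Lemma102 c') :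
    Step18_range1 c' := by
  intro ε hε
  obtain ⟨c, hc, C₁, D₁, h1⟩ := h101
  obtain ⟨C₂, D₂, h2⟩ := h102
  -- nonnegative versions of the constants
  set A₁ : ℝ := |C₁| with hA₁
  set A₂ : ℝ := |C₂| with hA₂
  set G : ℝ := 4 * Real.exp (9 / 2) * (3 * π * (1 + 5 * |c'|)) ^ 2 / 500 with hG
  set Kt : ℝ := A₁ * (G + A₂) * (1 + 6 * Real.exp 320) * (((9 + 10).factorial : ℝ) / c ^ (9 + 10)) with hKt
  set Kw : ℝ := 8 * Real.exp 77 * A₁ * A₂ with hKw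
  have hKt0 : 0 ≤ Kt := by positivity
  have hKw0 : 0 ≤ Kw := by positivity
  obtain ⟨D₃, hD₃⟩ := exists_nat_le_log (max 3 (max (2 * Kt / (ε * π)) (2 * Kw / (ε * π))))
  refine ⟨max (max D₁ D₂) D₃, fun D _ χ hD hq hp hA j hj => ?_⟩
  have hD1 : D₁ ≤ D := le_trans (le_trans (le_max_left _ _) (le_max_left _ _)) hD
  have hD2 : D₂ ≤ D := le_trans (le_trans (le_max_right _ _) (le_max_left _ _)) hD
  have hlog := hD₃ D (le_trans (le_max_right _ _) hD)
  have hL3 : 3 ≤ ell D := le_trans (le_max_left _ _) hlog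
  have hKt' : 2 * Kt / (ε * π) ≤ ell D := le_trans (le_trans (le_max_left _ _) (le_max_right _ _)) hlog
  have hKw' : 2 * Kw / (ε * π) ≤ ell D := le_trans (le_trans (le_max_right _ _) (le_max_right _ _)) hlog
  have hℓ : 0 < ell D := by linarith
  have hL1 : 1 ≤ ell D := by linarith
  have h1D := h1 D χ hD1 hq hp hA j hj
  have h2D := h2 D χ hD2 hq hp hA j hj
  -- the four clauses, with `|C₁|, |C₂|`
  have hTc : 0 < bigT D ^ (-c) := Real.rpow_pos_of_pos (Real.exp_pos _) _
  have hv1t : ∀ y : ℝ, 1 ≤ y → y ≤ bigP D ^ (0.5 : ℝ) / bigT D →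
      ‖frakv1 c' χ j y‖ ≤ A₁ * bigT D ^ (-c) := fun y hy1 hy2 =>
    ((h1D y).1 hy1 hy2).trans (mul_le_mul_of_nonneg_right (le_abs_self _) hTc.le)
  have hv1w : ∀ y : ℝ, bigP D ^ (0.5 : ℝ) / bigT D < y → y ≤ bigP D ^ (0.5 : ℝ) →
      ‖frakv1 c' χ j y‖ ≤ A₁ * (ell D ^ 7)⁻¹ := fun y hy1 hy2 =>
    ((h1D y).2.2.2 (Or.inl ⟨hy1, hy2⟩)).trans (mul_le_mul_of_nonneg_right (le_abs_self _) (by positivity))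
  have hv2t : ∀ d r : ℕ, 1 ≤ d → 1 ≤ r → ((d * r : ℕ) : ℝ) ≤ bigP D ^ (0.5 : ℝ) / bigT D →
      ‖frakv2 c' χ j d r - deriv χ.LFunction 1 * PiW χ d r / 500 *
          (betaJ c' D (j + 1) * betaJ c' D (j + 2)) * Real.log (bigP D)‖ ≤ A₂ * (ell D ^ 15)⁻¹ :=
    fun d r hd hr hdr => ((h2D d r hd hr).1 hdr).trans
      (mul_le_mul_of_nonneg_right (le_abs_self _) (by positivity))
  have hv2w : ∀ d r : ℕ, 1 ≤ d → 1 ≤ r → bigP D ^ (0.5 : ℝ) / bigT D < ((d * r : ℕ) : ℝ) →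
      ((d * r : ℕ) : ℝ) ≤ bigP D ^ (0.5 : ℝ) → ‖frakv2 c' χ j d r‖ ≤ A₂ * (ell D ^ 7)⁻¹ :=
    fun d r hd hr h1' h2' => ((h2D d r hd hr).2.2.2 (Or.inl ⟨h1', h2'⟩)).trans
      (mul_le_mul_of_nonneg_right (le_abs_self _) (by positivity))
  have hbound := range1_bound_at c' χ hL3 hp j hc (abs_nonneg C₁) (abs_nonneg C₂) hv1t hv1w hv2t hv2w
  -- `α = π/𝓛⁹`; compare
  rw [Section2.alpha_eq_pi_div_ell9]
  have hεπ : 0 < ε * π := by positivity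
  have h39 : ell D ^ (1.1 : ℝ) / ell D ^ 14 ≤ 1 / ell D ^ 10 := by
    -- `𝓛^{1.1} ≤ 𝓛⁴`
    have h14 : ell D ^ (1.1 : ℝ) ≤ ell D ^ 4 := by
      calc ell D ^ (1.1 : ℝ) ≤ ell D ^ (4 : ℝ) := Real.rpow_le_rpow_of_exponent_le hL1 (by norm_num)
        _ = ell D ^ 4 := by norm_cast
    rw [div_le_div_iff₀ (by positivity) (by positivity)]
    calc ell D ^ (1.1 : ℝ) * ell D ^ 10 ≤ ell D ^ 4 * ell D ^ 10 := by gcongr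
      _ = 1 * ell D ^ 14 := by ring
  have hfinal : Kt / ell D ^ 10 + Kw * ell D ^ (1.1 : ℝ) / ell D ^ 14 ≤ ε * (π / ell D ^ 9) := by
    have hKt2 : Kt / ell D ^ 10 ≤ ε * π / 2 / ell D ^ 9 := by
      rw [div_le_div_iff₀ (by positivity) (by positivity)]
      have : Kt ≤ ε * π / 2 * ell D := by
        have := (div_le_iff₀ hεπ).mp hKt'
        linarith
      calc Kt * ell D ^ 9 ≤ (ε * π / 2 * ell D) * ell D ^ 9 := by gcongr
        _ = ε * π / 2 * ell D ^ 10 := by ring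
    have hKw2 : Kw * ell D ^ (1.1 : ℝ) / ell D ^ 14 ≤ ε * π / 2 / ell D ^ 9 := by
      calc Kw * ell D ^ (1.1 : ℝ) / ell D ^ 14 = Kw * (ell D ^ (1.1 : ℝ) / ell D ^ 14) := by ring
        _ ≤ Kw * (1 / ell D ^ 10) := mul_le_mul_of_nonneg_left h39 hKw0
        _ = Kw / ell D ^ 10 := by ring
        _ ≤ ε * π / 2 / ell D ^ 9 := by
            rw [div_le_div_iff₀ (by positivity) (by positivity)]
            have : Kw ≤ ε * π / 2 * ell D := by
              have := (div_le_iff₀ hεπ).mp hKw'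
              linarith
            calc Kw * ell D ^ 9 ≤ (ε * π / 2 * ell D) * ell D ^ 9 := by gcongr
              _ = ε * π / 2 * ell D ^ 10 := by ring
    have e : ε * (π / ell D ^ 9) = ε * π / 2 / ell D ^ 9 + ε * π / 2 / ell D ^ 9 := by ring
    rw [e]; exact add_le_add hKt2 hKw2
  exact hbound.trans hfinal

end Range1

end Literature.NumberTheory.LFunctions.Zhang2022.Sec18SjNorm
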